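/-
Copyright (c) 2026 the pub-hodgecm-mathlib formalisation cell (harness21).  Prover seat hodgecm-mathlib-LH4-p09 (g8), req620 Track A «(D-RAM) FOUR-FRAME» squad
(heir LEAD F0P3a-plan (g20) T19-24 «STAGE-1b PRE-SCOPING BY IDLE HANDS: ALLOWED AS SCOPING»; dealer LH4-plan (g12) WORD #49 «(L-model-G)»; heir dealer LH4-plan (g13)).  2026-09-04.
-/
import Summits.HodgeConjecture.HodgeConjecture.Theorems.F0P3cDyRamLabelledGluedLocusCensusFoot       -- (this seat): `ball_of_witness`; brings ClassCut (`latticeInLevel_diagonal_latt_glued_iff_kappa`, `tokenBall_class`, `orbit_mul_weight_eq`), LocusCensus (`tokenBall_iff_of_add_eq`)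
import Summits.HodgeConjecture.HodgeConjecture.Theorems.F0P3cDyRamLabelledCoreHangingStratumRead   -- ★ p859313 (this seat): brings ★ B7 socket `stratum_H_eq`, ★ (C) `coreHangingStratum_eq_iUnion_orbits`, ★ (D2) glue decomposition, ★ (A)∕(B)
import HarnessLib

/-!
# (D-RAM) four-frame, STAGE 1b scoping — unit (L-model-G) item (3) «H over ★ B7», ON THE CANCELLATION LOCUS: the labelled core-hanging stratum
# `H (2ρ, 2ρ, 2ρ)` cut by the diagonal level token when `|e₂ − e₁| = |e₂ − e₀|` — the sub-stratum census in `R`-currency (tube ∕ foot ∕ empty regimes)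

STAGE-1b SCOPING BRICK in the sense of heir LEAD F0P3a-plan (g20) T19-24 and dealer LH4-plan (g12) WORD #49 (unit «(L-model-G)», items (1)+(3): the honest
sub-stratum census where the mixed inequality cuts the core-hanging stratum): `Theorems/` only, statement-first, ★-only imports, helper lane
`--supports stmt-HodgeConjecture-24833 --as helper`; it PAYS NO tier-0 row and states no STAGE-1b law (count-neutral; rule 66: a census, not a law).

THE PICTURE (the `s = 0` twin of this seat's glued census ★ `F0P3cDyRamLabelledGluedLocusCensus`).  The core-hanging normal form is the glued one at `s = 0`:
`V(x, ζ, y″) = (1 0 0; x ϖ^ρ 0; xζ+y″ ϖ^ρζ ϖ^{2ρ})`, `x, ζ, y″` units with `|xζ + y″| = 1`; its glue invariant `κ = y″∕(xζ)` is a unit with `|1 + κ| = 1`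
(ADMISSIBLE class), a lattice invariant modulo `𝔭^ρ` (★ B7 (iv)).  Off the locus ★ p859313 gives the labelled H weight; ON the locus `v(e₂ − e₁) = v(e₂ − e₀) = k`
the token reads `([|eᵢ| ≤ |ϖ|^ℓ] ∧ |e₁ − e₀| ≤ |ϖ|^{ℓ+ρ} ∧ ℓ + ρ ≤ k) ∧ |ϖ|^k·|κ + g_e| ≤ |ϖ|^{ℓ+2ρ}` (§1; `g_e = (e₂−e₁)∕(e₂−e₀)`, a unit), a class
condition; ★ B7 EXPORTS the orbit decompositions (★ (C) `coreHangingStratum_eq_iUnion_orbits` on the tube over the admissible representatives, ★ (D2)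
`coreHangingStratum_eq_iUnion_orbits_glue` on the foot over the stability ball), the disjointness `pairwise_disjoint_orbits_of` for any sub-index-set, and the
per-orbit sum `finsum_stabiliserWeight_orbit_eq`; so the label simply SHRINKS THE INDEX SET by the token ball:
* §1 `latticeInLevel_diagonal_latt_coreHanging_iff_onLocus` (read), `tokenBall_unit_of_le` (vacuous regime `ℓ + 2ρ ≤ k`).
* §2 **`finsum_stabiliserWeight_stratum_H_sep_onLocus_tube_eq_ncard_mul`** (`2ρ ≤ n₁, n₂`, `ρ ≤ n₃`):
  `Σᶠ_{M ∈ H, diag(e)M ⊆ ϖ^ℓM} w = [outer] · #{g ∈ R : |1 + g| = 1 ∧ |ϖ|^k·|g + g_e| ≤ |ϖ|^{ℓ+2ρ}} · q^{ρ+⌊ρ∕2⌋}`;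
  **`finsum_stabiliserWeight_stratum_H_sep_onLocus_foot_eq_ncard_mul`** (`n₁ = n₂ = n₃ = m`, `ρ ≤ m < 2ρ`): the same with the index set
  `{g ∈ R : |g + g₀| ≤ |ϖ|^{2ρ−m} ∧ token ball}` (`g₀ = (β−1)∕(α−1)`; admissibility is automatic on the stability ball, ★ `v_one_add_eq_one_of_glue`);
  `…_H_sep_eq_zero_of_ne ∕ _of_lt_rho ∕ _of_ne₃` — the three EMPTY regimes (any token), from ★ (D1).
The closed forms (★ (B) admissible count in the vacuous regime ⇒ ★ B7's `(q−2)q^{2ρ−1}`; ★ (D1) `ncard_glue_representatives_eq` in the genuine one, where the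
token ball is admissible iff `|e₁ − e₀| = |ϖ|^k`) are the next file.

HONEST LABEL: scoping inventory; STAGE-1b tier-0 rows T₊∕T₋∕regular stay OPEN; HC_CM is proved only modulo the 7 printed citations (2 remaining named
inputs: hLiu418 = `stmt-HodgeConjecture-24832`, h413 = `stmt-HodgeConjecture-24833`) until rung 0 closes.

## References
* [Kottwitz1986BaseChangeUnits] R. E. Kottwitz, *Base change for unit elements of Hecke algebras*, Compositio Math. 60 (1986), §1 pp. 240–241 (lattice counts via torus orbits and stabilisers).
* [Rogawski1990] J. D. Rogawski, *Automorphic Representations of Unitary Groups in Three Variables*, Ann. of Math. Stud. 123 (1990), §4.9 Prop. 4.9.1 (a) p. 55.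
* [Serre1980Trees] J.-P. Serre, *Trees*, Springer (1980), Ch. II §1.1 (lattices, the ultrametric inequality).
-/

set_option autoImplicit false

noncomputable section

namespace Summit.HodgeConjecture.HodgeConjecture.Cruxes.H413.F0P3cDyRamLabelledCoreHangingLocusCensus

open Matrix WithZero
open Literature.NumberTheory.Automorphic Literature.NumberTheory.Automorphic.HermitianLattice
open Literature.NumberTheory.Automorphic.UnitaryLatticeTree Literature.NumberTheory.Automorphic.UnitaryThreeFourFrame
open Literature.NumberTheory.LocalFields.WildQuadraticDatum
open Summit.HodgeConjecture.HodgeConjecture.Cruxes.H413.F0P3cDyRamDiagonalTorusDefs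
open Summit.HodgeConjecture.HodgeConjecture.Cruxes.H413.F0P3cDyRamDiagonalStrataDefs
open Summit.HodgeConjecture.HodgeConjecture.Cruxes.H413.F0P3cDyRamDiagonalGluedTorusOrbits (exists_gl_coe_eq_glued)
open Summit.HodgeConjecture.HodgeConjecture.Cruxes.H413.F0P3cDyRamDiagonalGluedStabiliserIndex (ne_zero_and_v_lt_one_of_v_eq_exp)
open Summit.HodgeConjecture.HodgeConjecture.Cruxes.H413.F0P3cDyRamDiagonalGluedStabiliserIndexFull (ncard_unitTorus_orbit_latt_glued_eq)
open Summit.HodgeConjecture.HodgeConjecture.Cruxes.H413.F0P3cDyRamDiagonalCoreHangingOrbits (exists_coreHanging_of_mem_orbit)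
open Summit.HodgeConjecture.HodgeConjecture.Cruxes.H413.F0P3cDyRamDiagonalCoreHangingCount
open Summit.HodgeConjecture.HodgeConjecture.Cruxes.H413.F0P3cDyRamDiagonalCoreHangingFoot
open Summit.HodgeConjecture.HodgeConjecture.Cruxes.H413.F0P3cDyRamDiagonalCoreHangingGlueCount
open Summit.HodgeConjecture.HodgeConjecture.Cruxes.H413.F0P3cDyRamDiagonalCoreHangingSocket (stratum_H_eq)
open Summit.HodgeConjecture.HodgeConjecture.Cruxes.H413.F0P3cDyRamDiagonalStratumTools (finsum_mem_eq_ncard_mul)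
open Summit.HodgeConjecture.HodgeConjecture.Cruxes.H413.F0P3cDyRamElementDatumParity (isoceles_of_isElementDatum)
open Summit.HodgeConjecture.HodgeConjecture.Cruxes.H413.F0P3cDyRamFourFrameCensusDefs
open Summit.HodgeConjecture.HodgeConjecture.Cruxes.H413.F0P3cDyRamLabelledGluedClassCut
open Summit.HodgeConjecture.HodgeConjecture.Cruxes.H413.F0P3cDyRamLabelledGluedLocusCensus (tokenBall_iff_of_add_eq)
open scoped Valued WithZero Matrix MatrixGroups

/-! ## §1  The token on the core-hanging normal form, on the locus -/

section Read

variable {K : Type*} [Field K] [Valued K ℤᵐ⁰]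

/-- **THE TOKEN ON THE CORE-HANGING NORMAL FORM, ON THE LOCUS** (`v(e₂−e₀) = v(e₂−e₁) = k`, `|x| = |ζ| = 1`; `κ = y″∕(xζ)`, `g_e = (e₂−e₁)∕(e₂−e₀)`):
`diag(e)·latt V ⊆ ϖ^ℓ·latt V ⟺ (([|eᵢ| ≤ |ϖ|^ℓ] ∧ |e₁ − e₀| ≤ |ϖ|^{ℓ+ρ}) ∧ ℓ + ρ ≤ k) ∧ |ϖ|^k·|κ + g_e| ≤ |ϖ|^{ℓ+2ρ}` (the glued read at `s = 0`; unlike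
`s > 0` the conjunct `|e₁ − e₀| ≤ |ϖ|^{ℓ+ρ}` does not collapse, the two differences having equal size). [cite: Kottwitz1986BaseChangeUnits, §1 pp. 240–241] -/
theorem latticeInLevel_diagonal_latt_coreHanging_iff_onLocus {ϖ : K} (hϖ : Valued.v ϖ = exp (-1 : ℤ)) (ℓ ρ k : ℕ) (e : Fin 3 → K)
    (hk : Valued.v (e 2 - e 0) = Valued.v ϖ ^ k) (hloc : Valued.v (e 2 - e 1) = Valued.v ϖ ^ k) {x ζ : K}
    (hx : Valued.v x = 1) (hζ : Valued.v ζ = 1) (y'' : K) :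
    LatticeInLevel ϖ ℓ (Matrix.diagonal e) (latt (!![1, 0, 0; x, ϖ ^ ρ, 0; x * ζ + y'', ϖ ^ ρ * ζ, ϖ ^ (2 * ρ)] : Matrix (Fin 3) (Fin 3) K)) ↔
      (((Valued.v (e 0) ≤ Valued.v ϖ ^ ℓ ∧ Valued.v (e 1) ≤ Valued.v ϖ ^ ℓ ∧ Valued.v (e 2) ≤ Valued.v ϖ ^ ℓ) ∧
          Valued.v (e 1 - e 0) ≤ Valued.v ϖ ^ (ℓ + ρ)) ∧ ℓ + ρ ≤ k) ∧
        Valued.v ϖ ^ k * Valued.v (y'' / (x * ζ) + (e 2 - e 1) / (e 2 - e 0)) ≤ Valued.v ϖ ^ (ℓ + 2 * ρ) := by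
  obtain ⟨hϖ0, -⟩ := ne_zero_and_v_lt_one_of_v_eq_exp hϖ
  have hvϖ0 : Valued.v ϖ ≠ 0 := (Valuation.ne_zero_iff _).2 hϖ0
  have he : e 2 ≠ e 0 := fun h => by
    rw [h, sub_self, map_zero] at hk
    exact pow_ne_zero k hvϖ0 hk.symm
  have hp : ∀ m n : ℕ, Valued.v ϖ ^ m ≤ Valued.v ϖ ^ n ↔ n ≤ m := fun m n => UnitaryLatticeTree.v_pow_le_v_pow_iff hϖ m n
  have h := latticeInLevel_diagonal_latt_glued_iff_kappa hϖ0 ℓ ρ 0 e he hx hζ y''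
  simp only [add_zero] at h
  rw [h, hloc, hk, hp]
  constructor
  · rintro ⟨h0, h1, h2, h3⟩; exact ⟨⟨⟨h0, h1⟩, h2⟩, h3⟩
  · rintro ⟨⟨⟨h0, h1⟩, h2⟩, h3⟩; exact ⟨h0, h1, h2, h3⟩

/-- **VACUOUS REGIME FOR UNITS** `ℓ + 2ρ ≤ k`: the token ball holds for every unit `g` and unit `h` (`|g + h| ≤ 1`). [cite: Serre1980Trees, II §1.1] -/
theorem tokenBall_unit_of_le {ϖ : K} (hϖ1 : Valued.v ϖ ≤ 1) {k ℓ ρ : ℕ} (hk : ℓ + 2 * ρ ≤ k) {g h : K} (hg : Valued.v g = 1) (hh : Valued.v h = 1) :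
    Valued.v ϖ ^ k * Valued.v (g + h) ≤ Valued.v ϖ ^ (ℓ + 2 * ρ) := by
  refine (mul_le_mul' (pow_le_pow_right_of_le_one' hϖ1 hk) ((Valuation.map_add _ _ _).trans (max_le hg.le hh.le))).trans ?_
  rw [mul_one]

end Read

/-! ## §2  The on-locus census of the labelled H weight in `R`-currency -/

section Census

variable {K : Type} [Field K] [Valued K ℤᵐ⁰] [Fintype 𝓀[K]] {σ : K →+* K} {ϖ : K} {d t : ℕ} {α β : K} {N₀ n₁ n₂ n₃ : ℕ} {T : GL (Fin 3) K}

/-- **HEAD (TUBE, `R`-CURRENCY) — THE LABELLED H WEIGHT ON THE LOCUS** (`2ρ ≤ n₁`, `2ρ ≤ n₂`, `ρ ≤ n₃`; `v(e₂−e₀) = v(e₂−e₁) = k`): for any irredundant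
complete system `R` of the `σ`-fixed units modulo `𝔭^ρ` (★ (iv-c) at `t = 0`),
`Σᶠ_{M ∈ H, diag(e)M ⊆ ϖ^ℓM} 1∕[𝒰 : S_F(M)] = [outer] · #{g ∈ R : |1 + g| = 1 ∧ |ϖ|^k·|g + g_e| ≤ |ϖ|^{ℓ+2ρ}} · q^{ρ+⌊ρ∕2⌋}` — ★ B7 `stratum_H_eq`, ★ (C)
`coreHangingStratum_eq_iUnion_orbits` (the stratum is the disjoint union of the unit-torus orbits of `V(1,1,g)` over the ADMISSIBLE representatives), the token
constant `= [outer] ∧ ball(g)` on each orbit (§1 + ★ `exists_coreHanging_of_mem_orbit`), ★ `finsum_stabiliserWeight_orbit_eq`.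
[cite: Kottwitz1986BaseChangeUnits, §1 pp. 240–241] [cite: Rogawski1990, §4.9 Prop. 4.9.1 (a) p. 55] -/
theorem finsum_stabiliserWeight_stratum_H_sep_onLocus_tube_eq_ncard_mul (hD : IsRamifiedQuadraticDatum σ ϖ d t) (h2 : Valued.v (2 : K) < 1)
    (hE : IsElementDatum σ ϖ N₀ α β n₁ n₂ n₃) (hT : (T : Matrix (Fin 3) (Fin 3) K) = Matrix.diagonal ![α, β, 1])
    (ρ : ℕ) (hρ : 1 ≤ ρ) (htube : 2 * ρ ≤ n₁ ∧ 2 * ρ ≤ n₂) (hn₃ : ρ ≤ n₃) (ℓ k : ℕ) (e : Fin 3 → K)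
    (hk : Valued.v (e 2 - e 0) = Valued.v ϖ ^ k) (hloc : Valued.v (e 2 - e 1) = Valued.v ϖ ^ k) {R : Set K} (hRfin : R.Finite)
    (hR1 : ∀ g ∈ R, σ g = g ∧ Valued.v g = 1) (hR2 : ∀ f : K, σ f = f → Valued.v f = 1 → ∃ g ∈ R, Valued.v (f - g) ≤ Valued.v ϖ ^ ρ)
    (hR3 : ∀ g ∈ R, ∀ g' ∈ R, Valued.v (g - g') ≤ Valued.v ϖ ^ ρ → g = g') :
    ∑ᶠ M ∈ {M | M ∈ stratum σ ϖ T ![2 * ρ, 2 * ρ, 2 * ρ] ∧ LatticeInLevel ϖ ℓ (Matrix.diagonal e) M}, stabiliserWeight σ M =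
      if ((Valued.v (e 0) ≤ Valued.v ϖ ^ ℓ ∧ Valued.v (e 1) ≤ Valued.v ϖ ^ ℓ ∧ Valued.v (e 2) ≤ Valued.v ϖ ^ ℓ) ∧
          Valued.v (e 1 - e 0) ≤ Valued.v ϖ ^ (ℓ + ρ)) ∧ ℓ + ρ ≤ k then
        ({g ∈ R | Valued.v (1 + g) = 1 ∧ Valued.v ϖ ^ k * Valued.v (g + (e 2 - e 1) / (e 2 - e 0)) ≤ Valued.v ϖ ^ (ℓ + 2 * ρ)}.ncard : ℚ) *
          (Fintype.card 𝓀[K] : ℚ) ^ (ρ + ρ / 2)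
      else 0 := by
  classical
  have hTr := trace_bound_of_isRamifiedQuadraticDatum hD h2
  obtain ⟨hσ, hvσ, hϖ, hfix, hd, -, -⟩ := hD
  obtain ⟨hαn, hβn, -, -, -, h₁, h₂, h₃, -, -, -⟩ := hE
  have hα := UnitaryThreeFourFrame.v_eq_one_of_mul_map_eq_one hvσ hαn
  have hβ := UnitaryThreeFourFrame.v_eq_one_of_mul_map_eq_one hvσ hβn
  have h₃' : Valued.v (β - α) = Valued.v ϖ ^ n₃ := by rw [Valuation.map_sub_swap, h₃]
  obtain ⟨hϖ0, hϖ1⟩ := ne_zero_and_v_lt_one_of_v_eq_exp hϖ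
  have hq : 1 < Nat.card 𝓀[K] := Finite.one_lt_card
  have hpρ : ϖ ^ ρ ≠ 0 := pow_ne_zero ρ hϖ0
  have hpr : ϖ ^ (2 * ρ) ≠ 0 := pow_ne_zero _ hϖ0
  -- the orbits and the token on them
  set Orb : K → Set (Submodule 𝒪[K] (Fin 3 → K)) := fun g =>
    {M | ∃ u ∈ unitTorus K 3, M = mapGL (diagGLUnits u) (latt (!![1, 0, 0; 1, ϖ ^ ρ, 0; 1 * 1 + g, ϖ ^ ρ * 1, ϖ ^ (2 * ρ)] : Matrix (Fin 3) (Fin 3) K))}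
    with hOrb
  have hread : ∀ g ∈ R, Valued.v (1 + g) = 1 → ∀ M ∈ Orb g, (LatticeInLevel ϖ ℓ (Matrix.diagonal e) M ↔
      (((Valued.v (e 0) ≤ Valued.v ϖ ^ ℓ ∧ Valued.v (e 1) ≤ Valued.v ϖ ^ ℓ ∧ Valued.v (e 2) ≤ Valued.v ϖ ^ ℓ) ∧
          Valued.v (e 1 - e 0) ≤ Valued.v ϖ ^ (ℓ + ρ)) ∧ ℓ + ρ ≤ k) ∧
        Valued.v ϖ ^ k * Valued.v (g + (e 2 - e 1) / (e 2 - e 0)) ≤ Valued.v ϖ ^ (ℓ + 2 * ρ)) := by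
    rintro g hg h1g M ⟨u, hu, rfl⟩
    obtain ⟨V₀, hV₀⟩ := exists_gl_coe_eq_glued (1 : K) 1 g hpρ hpr
    obtain ⟨x', ζ', y₁, hx', hζ', -, -, hκ, hM⟩ := exists_coreHanging_of_mem_orbit u hu (hR1 g hg).2 h1g (ϖ ^ ρ) (ϖ ^ (2 * ρ)) V₀ hV₀
    rw [← hV₀, hM, latticeInLevel_diagonal_latt_coreHanging_iff_onLocus hϖ ℓ ρ k e hk hloc hx' hζ' y₁, hκ]
  have hfinOrb : ∀ g ∈ R, (Orb g).Finite := fun g hg => by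
    obtain ⟨V₀, hV₀⟩ := exists_gl_coe_eq_glued (1 : K) 1 g hpρ hpr
    have hV0 : (V₀ : Matrix (Fin 3) (Fin 3) K) = !![1, 0, 0; 1, ϖ ^ ρ, 0; 1 * 1 + g, ϖ ^ ρ * 1, ϖ ^ (2 * ρ + 0)] := by rw [Nat.add_zero]; exact hV₀
    have hcard := ncard_unitTorus_orbit_latt_glued_eq hϖ hρ 0 (map_one _) (map_one _) (by rw [pow_zero]; exact (hR1 g hg).2) V₀ hV0
    simp only [hOrb]
    rw [← hV₀]
    refine Set.finite_of_ncard_ne_zero ?_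
    rw [hcard]
    exact mul_ne_zero (mul_ne_zero (by omega) (pow_ne_zero _ (by omega))) (mul_ne_zero (by omega) (pow_ne_zero _ (by omega)))
  have hdec := coreHangingStratum_eq_iUnion_orbits hσ hvσ hϖ hTr T hT hα hβ h₁ h₂ h₃' hρ htube.1 htube.2 hn₃ hR1 hR2
  have hconst := orbit_mul_weight_eq hq hρ 0
  simp only [Nat.mul_zero, Nat.add_zero] at hconst
  rw [← Nat.card_eq_fintype_card]
  by_cases hout : ((Valued.v (e 0) ≤ Valued.v ϖ ^ ℓ ∧ Valued.v (e 1) ≤ Valued.v ϖ ^ ℓ ∧ Valued.v (e 2) ≤ Valued.v ϖ ^ ℓ) ∧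
      Valued.v (e 1 - e 0) ≤ Valued.v ϖ ^ (ℓ + ρ)) ∧ ℓ + ρ ≤ k
  · rw [if_pos hout]
    set S : Set K := {g ∈ R | Valued.v (1 + g) = 1 ∧ Valued.v ϖ ^ k * Valued.v (g + (e 2 - e 1) / (e 2 - e 0)) ≤ Valued.v ϖ ^ (ℓ + 2 * ρ)} with hS
    have hSfin : S.Finite := hRfin.subset (Set.sep_subset _ _)
    have hset : {M | M ∈ stratum σ ϖ T ![2 * ρ, 2 * ρ, 2 * ρ] ∧ LatticeInLevel ϖ ℓ (Matrix.diagonal e) M} = ⋃ g ∈ S, Orb g := by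
      ext M
      rw [Set.mem_setOf_eq, stratum_H_eq hvσ hfix hϖ T hρ, hdec, Set.mem_iUnion₂, Set.mem_iUnion₂]
      constructor
      · rintro ⟨⟨g, hg, hMg⟩, hL⟩
        exact ⟨g, ⟨hg.1, hg.2, ((hread g hg.1 hg.2 M hMg).1 hL).2⟩, hMg⟩
      · rintro ⟨g, hg, hMg⟩
        exact ⟨⟨g, ⟨hg.1, hg.2.1⟩, hMg⟩, (hread g hg.1 hg.2.1 M hMg).2 ⟨hout, hg.2.2⟩⟩
    rw [hset, finsum_mem_biUnion (pairwise_disjoint_orbits_of hϖ ρ (Set.sep_subset _ _) (fun g hg => (hR1 g hg).2) (fun g hg => hg.2.1) hR3)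
        hSfin (fun g hg => hfinOrb g hg.1),
      finsum_mem_eq_ncard_mul hSfin _ _ (fun g hg => finsum_stabiliserWeight_orbit_eq hσ hvσ hfix hϖ hd hρ (hR1 g hg.1).1 (hR1 g hg.1).2), hconst]
  · rw [if_neg hout]
    have hset : {M | M ∈ stratum σ ϖ T ![2 * ρ, 2 * ρ, 2 * ρ] ∧ LatticeInLevel ϖ ℓ (Matrix.diagonal e) M} = ∅ :=
      Set.eq_empty_of_forall_notMem fun M ⟨hM, hL⟩ => by
        rw [stratum_H_eq hvσ hfix hϖ T hρ, hdec, Set.mem_iUnion₂] at hM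
        obtain ⟨g, hg, hMg⟩ := hM
        exact hout ((hread g hg.1 hg.2 M hMg).1 hL).1
    rw [hset, finsum_mem_empty]

/-- **HEAD (FOOT, `R`-CURRENCY) — THE LABELLED H WEIGHT ON THE LOCUS** (equilateral foot `n₁ = n₂ = n₃ = m`, `ρ ≤ m < 2ρ`; `v(e₂−e₀) = v(e₂−e₁) = k`;
`g₀ = (β−1)∕(α−1)`): `Σᶠ_{M ∈ H, diag(e)M ⊆ ϖ^ℓM} 1∕[𝒰 : S_F(M)] = [outer] · #{g ∈ R : |g + g₀| ≤ |ϖ|^{2ρ−m} ∧ |ϖ|^k·|g + g_e| ≤ |ϖ|^{ℓ+2ρ}} · q^{ρ+⌊ρ∕2⌋}`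
(★ (D2) `coreHangingStratum_eq_iUnion_orbits_glue`; admissibility is automatic on the stability ball, ★ `v_one_add_eq_one_of_glue`).
[cite: Kottwitz1986BaseChangeUnits, §1 pp. 240–241] [cite: Rogawski1990, §4.9 Prop. 4.9.1 (a) p. 55] -/
theorem finsum_stabiliserWeight_stratum_H_sep_onLocus_foot_eq_ncard_mul (hD : IsRamifiedQuadraticDatum σ ϖ d t) (h2 : Valued.v (2 : K) < 1)
    (hE : IsElementDatum σ ϖ N₀ α β n₁ n₂ n₃) (hT : (T : Matrix (Fin 3) (Fin 3) K) = Matrix.diagonal ![α, β, 1])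
    (ρ : ℕ) (hρ : 1 ≤ ρ) (h12 : n₁ = n₂) (h13 : n₁ = n₃) (hρm : ρ ≤ n₁) (hm : n₁ < 2 * ρ) (ℓ k : ℕ) (e : Fin 3 → K)
    (hk : Valued.v (e 2 - e 0) = Valued.v ϖ ^ k) (hloc : Valued.v (e 2 - e 1) = Valued.v ϖ ^ k) {R : Set K} (hRfin : R.Finite)
    (hR1 : ∀ g ∈ R, σ g = g ∧ Valued.v g = 1) (hR2 : ∀ f : K, σ f = f → Valued.v f = 1 → ∃ g ∈ R, Valued.v (f - g) ≤ Valued.v ϖ ^ ρ)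
    (hR3 : ∀ g ∈ R, ∀ g' ∈ R, Valued.v (g - g') ≤ Valued.v ϖ ^ ρ → g = g') :
    ∑ᶠ M ∈ {M | M ∈ stratum σ ϖ T ![2 * ρ, 2 * ρ, 2 * ρ] ∧ LatticeInLevel ϖ ℓ (Matrix.diagonal e) M}, stabiliserWeight σ M =
      if ((Valued.v (e 0) ≤ Valued.v ϖ ^ ℓ ∧ Valued.v (e 1) ≤ Valued.v ϖ ^ ℓ ∧ Valued.v (e 2) ≤ Valued.v ϖ ^ ℓ) ∧
          Valued.v (e 1 - e 0) ≤ Valued.v ϖ ^ (ℓ + ρ)) ∧ ℓ + ρ ≤ k then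
        ({g ∈ R | Valued.v (g + (β - 1) / (α - 1)) ≤ Valued.v ϖ ^ (2 * ρ - n₁) ∧
            Valued.v ϖ ^ k * Valued.v (g + (e 2 - e 1) / (e 2 - e 0)) ≤ Valued.v ϖ ^ (ℓ + 2 * ρ)}.ncard : ℚ) *
          (Fintype.card 𝓀[K] : ℚ) ^ (ρ + ρ / 2)
      else 0 := by
  classical
  have hTr := trace_bound_of_isRamifiedQuadraticDatum hD h2
  obtain ⟨hσ, hvσ, hϖ, hfix, hd, -, -⟩ := hD
  obtain ⟨hαn, hβn, -, -, -, h₁, h₂, h₃, -, -, -⟩ := hE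
  subst h12 h13
  have hα := UnitaryThreeFourFrame.v_eq_one_of_mul_map_eq_one hvσ hαn
  have hβ := UnitaryThreeFourFrame.v_eq_one_of_mul_map_eq_one hvσ hβn
  have h₃' : Valued.v (β - α) = Valued.v ϖ ^ n₁ := by rw [Valuation.map_sub_swap, h₃]
  obtain ⟨hϖ0, hϖ1⟩ := ne_zero_and_v_lt_one_of_v_eq_exp hϖ
  have hq : 1 < Nat.card 𝓀[K] := Finite.one_lt_card
  have hpρ : ϖ ^ ρ ≠ 0 := pow_ne_zero ρ hϖ0
  have hpr : ϖ ^ (2 * ρ) ≠ 0 := pow_ne_zero _ hϖ0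
  have hadm : ∀ {g : K}, Valued.v (g + (β - 1) / (α - 1)) ≤ Valued.v ϖ ^ (2 * ρ - n₁) → Valued.v (1 + g) = 1 :=
    fun hg => v_one_add_eq_one_of_glue hϖ h₂ h₃' (by omega) hg
  set Orb : K → Set (Submodule 𝒪[K] (Fin 3 → K)) := fun g =>
    {M | ∃ u ∈ unitTorus K 3, M = mapGL (diagGLUnits u) (latt (!![1, 0, 0; 1, ϖ ^ ρ, 0; 1 * 1 + g, ϖ ^ ρ * 1, ϖ ^ (2 * ρ)] : Matrix (Fin 3) (Fin 3) K))}
    with hOrb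
  have hread : ∀ g ∈ R, Valued.v (1 + g) = 1 → ∀ M ∈ Orb g, (LatticeInLevel ϖ ℓ (Matrix.diagonal e) M ↔
      (((Valued.v (e 0) ≤ Valued.v ϖ ^ ℓ ∧ Valued.v (e 1) ≤ Valued.v ϖ ^ ℓ ∧ Valued.v (e 2) ≤ Valued.v ϖ ^ ℓ) ∧
          Valued.v (e 1 - e 0) ≤ Valued.v ϖ ^ (ℓ + ρ)) ∧ ℓ + ρ ≤ k) ∧
        Valued.v ϖ ^ k * Valued.v (g + (e 2 - e 1) / (e 2 - e 0)) ≤ Valued.v ϖ ^ (ℓ + 2 * ρ)) := by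
    rintro g hg h1g M ⟨u, hu, rfl⟩
    obtain ⟨V₀, hV₀⟩ := exists_gl_coe_eq_glued (1 : K) 1 g hpρ hpr
    obtain ⟨x', ζ', y₁, hx', hζ', -, -, hκ, hM⟩ := exists_coreHanging_of_mem_orbit u hu (hR1 g hg).2 h1g (ϖ ^ ρ) (ϖ ^ (2 * ρ)) V₀ hV₀
    rw [← hV₀, hM, latticeInLevel_diagonal_latt_coreHanging_iff_onLocus hϖ ℓ ρ k e hk hloc hx' hζ' y₁, hκ]
  have hfinOrb : ∀ g ∈ R, (Orb g).Finite := fun g hg => by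
    obtain ⟨V₀, hV₀⟩ := exists_gl_coe_eq_glued (1 : K) 1 g hpρ hpr
    have hV0 : (V₀ : Matrix (Fin 3) (Fin 3) K) = !![1, 0, 0; 1, ϖ ^ ρ, 0; 1 * 1 + g, ϖ ^ ρ * 1, ϖ ^ (2 * ρ + 0)] := by rw [Nat.add_zero]; exact hV₀
    have hcard := ncard_unitTorus_orbit_latt_glued_eq hϖ hρ 0 (map_one _) (map_one _) (by rw [pow_zero]; exact (hR1 g hg).2) V₀ hV0
    simp only [hOrb]
    rw [← hV₀]
    refine Set.finite_of_ncard_ne_zero ?_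
    rw [hcard]
    exact mul_ne_zero (mul_ne_zero (by omega) (pow_ne_zero _ (by omega))) (mul_ne_zero (by omega) (pow_ne_zero _ (by omega)))
  have hdec := coreHangingStratum_eq_iUnion_orbits_glue hσ hvσ hϖ hTr T hT hα hβ h₁ h₂ h₃' hρ hρm hm hR1 hR2
  have hconst := orbit_mul_weight_eq hq hρ 0
  simp only [Nat.mul_zero, Nat.add_zero] at hconst
  rw [← Nat.card_eq_fintype_card]
  by_cases hout : ((Valued.v (e 0) ≤ Valued.v ϖ ^ ℓ ∧ Valued.v (e 1) ≤ Valued.v ϖ ^ ℓ ∧ Valued.v (e 2) ≤ Valued.v ϖ ^ ℓ) ∧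
      Valued.v (e 1 - e 0) ≤ Valued.v ϖ ^ (ℓ + ρ)) ∧ ℓ + ρ ≤ k
  · rw [if_pos hout]
    set S : Set K := {g ∈ R | Valued.v (g + (β - 1) / (α - 1)) ≤ Valued.v ϖ ^ (2 * ρ - n₁) ∧
      Valued.v ϖ ^ k * Valued.v (g + (e 2 - e 1) / (e 2 - e 0)) ≤ Valued.v ϖ ^ (ℓ + 2 * ρ)} with hS
    have hSfin : S.Finite := hRfin.subset (Set.sep_subset _ _)
    have hset : {M | M ∈ stratum σ ϖ T ![2 * ρ, 2 * ρ, 2 * ρ] ∧ LatticeInLevel ϖ ℓ (Matrix.diagonal e) M} = ⋃ g ∈ S, Orb g := by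
      ext M
      rw [Set.mem_setOf_eq, stratum_H_eq hvσ hfix hϖ T hρ, hdec, Set.mem_iUnion₂, Set.mem_iUnion₂]
      constructor
      · rintro ⟨⟨g, hg, hMg⟩, hL⟩
        exact ⟨g, ⟨hg.1, hg.2, ((hread g hg.1 (hadm hg.2) M hMg).1 hL).2⟩, hMg⟩
      · rintro ⟨g, hg, hMg⟩
        exact ⟨⟨g, ⟨hg.1, hg.2.1⟩, hMg⟩, (hread g hg.1 (hadm hg.2.1) M hMg).2 ⟨hout, hg.2.2⟩⟩
    rw [hset, finsum_mem_biUnion (pairwise_disjoint_orbits_of hϖ ρ (Set.sep_subset _ _) (fun g hg => (hR1 g hg).2) (fun g hg => hadm hg.2.1) hR3)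
        hSfin (fun g hg => hfinOrb g hg.1),
      finsum_mem_eq_ncard_mul hSfin _ _ (fun g hg => finsum_stabiliserWeight_orbit_eq hσ hvσ hfix hϖ hd hρ (hR1 g hg.1).1 (hR1 g hg.1).2), hconst]
  · rw [if_neg hout]
    have hset : {M | M ∈ stratum σ ϖ T ![2 * ρ, 2 * ρ, 2 * ρ] ∧ LatticeInLevel ϖ ℓ (Matrix.diagonal e) M} = ∅ :=
      Set.eq_empty_of_forall_notMem fun M ⟨hM, hL⟩ => by
        rw [stratum_H_eq hvσ hfix hϖ T hρ, hdec, Set.mem_iUnion₂] at hM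
        obtain ⟨g, hg, hMg⟩ := hM
        exact hout ((hread g hg.1 (hadm hg.2) M hMg).1 hL).1
    rw [hset, finsum_mem_empty]

omit [Fintype 𝓀[K]] in
/-- **EMPTY OFF THE FOOT AND BELOW THE TUBE**: `n₁ ≠ n₂` and `¬(2ρ ≤ n₁ ∧ 2ρ ≤ n₂)` ⇒ the H stratum is empty (★ (D1)), so every label-cut weight vanishes.
[cite: Kottwitz1986BaseChangeUnits, §1 pp. 240–241] -/
theorem finsum_stabiliserWeight_stratum_H_sep_eq_zero_of_ne (hD : IsRamifiedQuadraticDatum σ ϖ d t) (hE : IsElementDatum σ ϖ N₀ α β n₁ n₂ n₃)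
    (hT : (T : Matrix (Fin 3) (Fin 3) K) = Matrix.diagonal ![α, β, 1]) (ρ : ℕ) (hρ : 1 ≤ ρ) (hne : n₁ ≠ n₂)
    (hlow : ¬ (2 * ρ ≤ n₁ ∧ 2 * ρ ≤ n₂)) (L : Submodule 𝒪[K] (Fin 3 → K) → Prop) :
    ∑ᶠ M ∈ {M | M ∈ stratum σ ϖ T ![2 * ρ, 2 * ρ, 2 * ρ] ∧ L M}, stabiliserWeight σ M = 0 := by
  obtain ⟨-, hvσ, hϖ, hfix, -, -, -⟩ := hD
  obtain ⟨hαn, hβn, -, -, -, h₁, h₂, -, -, -, -⟩ := hE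
  have hset : {M | M ∈ stratum σ ϖ T ![2 * ρ, 2 * ρ, 2 * ρ] ∧ L M} = ∅ :=
    Set.eq_empty_of_forall_notMem fun M ⟨hM, _⟩ => by
      rw [stratum_H_eq hvσ hfix hϖ T hρ, coreHangingStratum_eq_empty_of_ne σ hϖ T hT
        (UnitaryThreeFourFrame.v_eq_one_of_mul_map_eq_one hvσ hαn) (UnitaryThreeFourFrame.v_eq_one_of_mul_map_eq_one hvσ hβn) h₁ h₂ hne hlow] at hM
      exact hM
  rw [hset, finsum_mem_empty]

omit [Fintype 𝓀[K]] in
/-- **EMPTY WHEN TOO SHALLOW**: `n₁ = n₂ = m < ρ` ⇒ the H stratum is empty (★ (D1)), so every label-cut weight vanishes. [cite: Kottwitz1986BaseChangeUnits, §1 pp. 240–241] -/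
theorem finsum_stabiliserWeight_stratum_H_sep_eq_zero_of_lt_rho (hD : IsRamifiedQuadraticDatum σ ϖ d t) (hE : IsElementDatum σ ϖ N₀ α β n₁ n₂ n₃)
    (hT : (T : Matrix (Fin 3) (Fin 3) K) = Matrix.diagonal ![α, β, 1]) (ρ : ℕ) (hρ : 1 ≤ ρ) (h12 : n₁ = n₂) (hlt : n₁ < ρ)
    (L : Submodule 𝒪[K] (Fin 3 → K) → Prop) :
    ∑ᶠ M ∈ {M | M ∈ stratum σ ϖ T ![2 * ρ, 2 * ρ, 2 * ρ] ∧ L M}, stabiliserWeight σ M = 0 := by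
  obtain ⟨-, hvσ, hϖ, hfix, -, -, -⟩ := hD
  obtain ⟨hαn, hβn, -, -, -, h₁, h₂, h₃, -, -, -⟩ := hE
  subst h12
  have h₃' : Valued.v (β - α) = Valued.v ϖ ^ n₃ := by rw [Valuation.map_sub_swap, h₃]
  have hset : {M | M ∈ stratum σ ϖ T ![2 * ρ, 2 * ρ, 2 * ρ] ∧ L M} = ∅ :=
    Set.eq_empty_of_forall_notMem fun M ⟨hM, _⟩ => by
      rw [stratum_H_eq hvσ hfix hϖ T hρ, coreHangingStratum_eq_empty_of_lt_rho σ hϖ T hT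
        (UnitaryThreeFourFrame.v_eq_one_of_mul_map_eq_one hvσ hαn) (UnitaryThreeFourFrame.v_eq_one_of_mul_map_eq_one hvσ hβn) h₁ h₂ h₃' hlt] at hM
      exact hM
  rw [hset, finsum_mem_empty]

omit [Fintype 𝓀[K]] in
/-- **EMPTY ON A NON-EQUILATERAL FOOT**: `n₁ = n₂ = m < 2ρ`, `n₃ ≠ m` ⇒ the H stratum is empty (★ (D1)), so every label-cut weight vanishes.
[cite: Kottwitz1986BaseChangeUnits, §1 pp. 240–241] -/
theorem finsum_stabiliserWeight_stratum_H_sep_eq_zero_of_ne₃ (hD : IsRamifiedQuadraticDatum σ ϖ d t) (hE : IsElementDatum σ ϖ N₀ α β n₁ n₂ n₃)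
    (hT : (T : Matrix (Fin 3) (Fin 3) K) = Matrix.diagonal ![α, β, 1]) (ρ : ℕ) (hρ : 1 ≤ ρ) (h12 : n₁ = n₂) (hm : n₁ < 2 * ρ) (hn₃ : n₃ ≠ n₁)
    (L : Submodule 𝒪[K] (Fin 3 → K) → Prop) :
    ∑ᶠ M ∈ {M | M ∈ stratum σ ϖ T ![2 * ρ, 2 * ρ, 2 * ρ] ∧ L M}, stabiliserWeight σ M = 0 := by
  obtain ⟨-, hvσ, hϖ, hfix, -, -, -⟩ := hD
  obtain ⟨hαn, hβn, -, -, -, h₁, h₂, h₃, -, -, -⟩ := hE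
  subst h12
  have h₃' : Valued.v (β - α) = Valued.v ϖ ^ n₃ := by rw [Valuation.map_sub_swap, h₃]
  have hset : {M | M ∈ stratum σ ϖ T ![2 * ρ, 2 * ρ, 2 * ρ] ∧ L M} = ∅ :=
    Set.eq_empty_of_forall_notMem fun M ⟨hM, _⟩ => by
      rw [stratum_H_eq hvσ hfix hϖ T hρ, coreHangingStratum_eq_empty_of_ne₃ σ hϖ T hT
        (UnitaryThreeFourFrame.v_eq_one_of_mul_map_eq_one hvσ hαn) (UnitaryThreeFourFrame.v_eq_one_of_mul_map_eq_one hvσ hβn) h₁ h₂ h₃' hm hn₃] at hM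
      exact hM
  rw [hset, finsum_mem_empty]

end Census

end Summit.HodgeConjecture.HodgeConjecture.Cruxes.H413.F0P3cDyRamLabelledCoreHangingLocusCensus

end
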